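import Summits.AnomalousDissipation.AnomalousDissipation.Theses.StirringSphere
import Summits.AnomalousDissipation.AnomalousDissipation.Theses.Ensemble
import Summits.AnomalousDissipation.AnomalousDissipation.Theorems.MomentParityPathField
import Summits.AnomalousDissipation.AnomalousDissipation.Theorems.MomentParityTimeAverages
import Summits.AnomalousDissipation.AnomalousDissipation.Theorems.MomentParityGalerkinEnsembleRealizationStubTimeAverages
import Literature.Analysis.FluidPDE.StatisticalSolutionEnergyEq
import Literature.Analysis.FluidPDE.WeakSolution
import Literature.Dynamics.Ergodic.BirkhoffErgodicTheoremProofs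
import HarnessLib.Audit

/-!
# Crux `EnsembleRealization` (stmt-AnomalousDissipation-0215; routes StirringSphere rank 5,
# Ensemble rank 3) — line `superposition-lift`: skeleton and kernel-checked composition

THE CRUX. For a smooth solenoidal mean-zero force `f` and budgets `E`, `ε > 0` there is
`M = M(f, E, ε)` such that at every viscosity `ν > 0`, every Foias–Prodi stationary statistical
solution `μ` of NS_ν(f) with mean energy `≤ E` and mean dissipation `≥ ε` is SHADOWED by one global
Leray–Hopf trajectory with `meanEnergy ≤ M` and `meanDissipation ≥ ε/2`.

THE LINE (Ambrosio–Trevisan superposition in `ℝ^∞` + the landed MomentParity trajectory-space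
layer). The Foias–Prodi Liouville identity `∫ ⟨F(u), Φ'(u)⟩ dμ = 0` on cylindrical tests says
exactly that the law `μ̂` of the Fourier coefficients solves the STATIONARY CONTINUITY EQUATION
`div(F μ̂) = 0` in `ℝ^∞` in duality with smooth cylindrical functions, with the coordinatewise
integrability `∫ |F_k| dμ < ∞` (finite mean energy: `|F_k(u)| ≤ |f̂_k| + ν λ_k R + 2π|k| R²` on the
FMRT support ball `‖u‖ ≤ R = ‖f‖₂/(4π²ν)`, in tree: `IsStationaryStatisticalSolution.ae_norm_le`).
Ambrosio–Trevisan's superposition principle in `ℝ^∞` (arXiv:1402.4788, Thm 7.1) then LIFTS `μ̂` to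
a probability measure on coefficient paths concentrated on modewise (= distributional,
`IsWeakNSSolutionForcedOn`) solutions with one-time marginals `μ̂`; Krylov–Bogoliubov averaging of
its shifts inside the compact trajectory space `𝒦 = pathSpace R (pathLip ν ‖f‖₁ R)` of route
MomentParity (the Lipschitz moduli `pathLip` bound the FULL Navier–Stokes vector field on the
ball, divergence form) gives a SHIFT-INVARIANT lift `Q` (`stub_superpositionLaw`). Because the
marginals are EXACTLY `μ̂` (no weak limit in the state variable), Fubini gives
`∫ energyMean dQ = ensembleEnergy μ` and `∫ dissMean ν K dQ ↑ ensembleDissipation ν μ`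
(`stub_marginalMeans`) — no leakage clause is needed, in contrast with the Galerkin sibling
`MomentParity.GalerkinEnsembleRealization`. The ONE OPEN STUB is ADMISSIBILITY
(`stub_admissibleLift`): a stationary distributional lift of a Foias–Prodi measure can be
upgraded to (or already is) a lift whose typical path is, after a time shift, a global
Leray–Hopf solution — the Leray–Hopf energy inequality along typical paths of a stationary
energy-class process (the exact typed residue of "Foias–Prodi ⇒ Vishik–Fursikov",
FoiasRosaTemam2019 p. 3). Given admissibility, the pathwise time-averaged energy inequality
(`stub_pathwiseCoupling`), the a.e. Birkhoff–Chebyshev selection `exists_good_point_ae` (proved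
here; a.e. variant of the landed `exists_mem_support_birkhoff_limits`) and the LANDED
`stub_timeAverages` of the sibling line conclude.

Stubs: `stub_superpositionLaw` (XL, known: Ambrosio–Trevisan 2014 Thm 7.1 + stationarisation),
`stub_marginalMeans` (M, Fubini + monotone convergence), `stub_admissibleLift` (OPEN — the crux's
content), `stub_pathwiseCoupling` (M/L, Leray–Hopf energy inequality + Parseval). Composition:
`ensembleRealization_of` (StirringSphere decl) and `ensemble_ensembleRealization_of` (the
byte-identical Ensemble decl).
-/

noncomputable section

-- every `Summit.AnomalousDissipation.AnomalousDissipation.…` name repeats the summit = sub-problem segment (D-0017 layout)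
set_option linter.dupNamespace false

open MeasureTheory Set Filter Topology Function Metric UnitAddTorus
open scoped BigOperators ENNReal InnerProductSpace RealInnerProductSpace

namespace Summit.AnomalousDissipation.AnomalousDissipation.Cruxes.EnsembleRealization.SuperpositionLift

open Literature.Analysis.FunctionSpaces Literature.Analysis.FunctionSpaces.Torus
open Literature.Analysis.FluidPDE Literature.Analysis.FluidPDE.Torus
open Summit.AnomalousDissipation.AnomalousDissipation.Theorems.MomentParity

variable {ν : ℝ} {f : UnitAddTorus (Fin 3) → EuclideanSpace ℝ (Fin 3)}
  {μ : Measure (Torus.energySpace (Fin 3))}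

/-! ### Stub 1 (XL, known): the stationary superposition lift -/

/-- **Stub (superposition law).** A Foias–Prodi stationary statistical solution `μ` of NS_ν(f)
carried by the ball `‖u‖ ≤ R` lifts to a shift-invariant probability law `Q` on the trajectory
space `𝒦 = pathSpace R (pathLip ν ‖f‖₁ R)` whose one-time marginals are the coefficient law of `μ`
and whose typical path is realised by a distributional (forced weak, `L²_t H¹`) solution on every
`[0, T)` (Ambrosio–Trevisan 2014, Thm 7.1, superposition principle in `ℝ^∞`, applied to the
Liouville identity on cylindrical tests with Stokes-mode test fields; Krylov–Bogoliubov averaging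
of the shifts in the compact `𝒦`; closedness of "concentrated on solutions" under weak limits with
fixed marginals as in loc. cit. (7.4)–(7.6)). [arXiv:1402.4788 Thm 7.1; FMRTTurbulence2001 IV (1.30)] -/
theorem stub_superpositionLaw (hν : 0 < ν) (hf : IsSmooth f) (hdiv : IsDivFree f) (hf0 : HasZeroMean f)
    (hμ : IsStationaryStatisticalSolution ν f μ) {R : ℝ} (hR0 : 0 ≤ R) (hR : ∀ᵐ u ∂μ, ‖u‖ ≤ R) :
    ∃ Q : Measure ↥(pathSpace R (pathLip ν (∫ x, ‖f x‖) R) : Set (Path (Fin 3))),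
      IsProbabilityMeasure Q ∧
      Q.map (pathShiftOn R (pathLip ν (∫ x, ‖f x‖) R) (pathShift_mapsTo R (pathLip ν (∫ x, ‖f x‖) R))) = Q ∧
      (∀ t, 0 ≤ t → Q.map (fun ω => fun k : Fin 3 → ℤ => pathExt ω.1 t k) =
        μ.map (fun u : Torus.energySpace (Fin 3) => fun k : Fin 3 → ℤ =>
          mFourierCoeff (EuclideanSpace.complexify ∘ (u.1 : UnitAddTorus (Fin 3) → EuclideanSpace ℝ (Fin 3))) k)) ∧
      (∀ᵐ ω ∂Q, ∃ v : ℝ → UnitAddTorus (Fin 3) → EuclideanSpace ℝ (Fin 3),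
        (∀ t, 0 ≤ t → MemLp (v t) 2 volume ∧
          ∀ k, mFourierCoeff (EuclideanSpace.complexify ∘ v t) k = pathExt ω.1 t k) ∧
        ∀ T, 0 < T → IsWeakNSSolutionForcedOn T ν (fun _ => f) (v 0) v ∧
          ∫⁻ t in Ioo 0 T, eGradNormSq (v t) < ∞) := by
  sorry

/-! ### Stub 2 (M, known): the two observables under the marginal identity -/

/-- **Stub (marginal means).** If the one-time marginals of a law `Q` on `𝒦` are the coefficient
law of a stationary statistical solution `μ`, then `∫ energyMean dQ = ensembleEnergy μ` (Fubini in
`(ω, t) ∈ 𝒦 × [0,1]` and Parseval) and the mean resolved dissipation `∫ dissMean ν K dQ` increases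
to `ensembleDissipation ν μ` as `K → ∞` (monotone convergence, finite mean enstrophy (1.29)).
[FMRTTurbulence2001 IV (1.29), (1.32)–(1.34)] -/
theorem stub_marginalMeans (hν : 0 < ν) (hμ : IsStationaryStatisticalSolution ν f μ) {R : ℝ}
    {L : (Fin 3 → ℤ) → ℝ} (Q : Measure ↥(pathSpace R L : Set (Path (Fin 3)))) [IsProbabilityMeasure Q]
    (hmarg : ∀ t, 0 ≤ t → Q.map (fun ω => fun k : Fin 3 → ℤ => pathExt ω.1 t k) =
      μ.map (fun u : Torus.energySpace (Fin 3) => fun k : Fin 3 → ℤ =>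
        mFourierCoeff (EuclideanSpace.complexify ∘ (u.1 : UnitAddTorus (Fin 3) → EuclideanSpace ℝ (Fin 3))) k)) :
    ∫ ω, energyMean ω.1 ∂Q = ensembleEnergy μ ∧
      ∀ δ, 0 < δ → ∃ K : ℕ, ensembleDissipation ν μ - δ ≤ ∫ ω, dissMean ν K ω.1 ∂Q := by
  sorry

/-! ### Stub 3 (OPEN — the content of the crux): admissibility of a stationary lift -/

/-- **Stub (admissible lift).** If a Foias–Prodi stationary statistical solution `μ` carried by
the ball `‖u‖ ≤ R` admits a shift-invariant lift to `𝒦` with marginals `μ̂` concentrated on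
distributional `L²_t H¹` solutions (the output of `stub_superpositionLaw`), then it admits such a
lift whose typical path is, after a time shift `s ≥ 0`, realised by a GLOBAL LERAY–HOPF solution
(`𝓕(u t) = ω̄(s + t)`). The Leray–Hopf energy inequalities along typical paths of a stationary
energy-class process with Foias–Prodi marginal: the typed residue of "Foias–Prodi ⇒
Vishik–Fursikov" (FoiasRosaTemam2019 p. 3, Def. 4.2–4.3, Thm 5.5). OPEN. -/
theorem stub_admissibleLift (hν : 0 < ν) (hf : IsSmooth f) (hdiv : IsDivFree f) (hf0 : HasZeroMean f)
    (hμ : IsStationaryStatisticalSolution ν f μ) {R : ℝ} (hR0 : 0 ≤ R) (hR : ∀ᵐ u ∂μ, ‖u‖ ≤ R)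
    (Q : Measure ↥(pathSpace R (pathLip ν (∫ x, ‖f x‖) R) : Set (Path (Fin 3)))) [IsProbabilityMeasure Q]
    (hθ : Q.map (pathShiftOn R (pathLip ν (∫ x, ‖f x‖) R) (pathShift_mapsTo R (pathLip ν (∫ x, ‖f x‖) R))) = Q)
    (hmarg : ∀ t, 0 ≤ t → Q.map (fun ω => fun k : Fin 3 → ℤ => pathExt ω.1 t k) =
      μ.map (fun u : Torus.energySpace (Fin 3) => fun k : Fin 3 → ℤ =>
        mFourierCoeff (EuclideanSpace.complexify ∘ (u.1 : UnitAddTorus (Fin 3) → EuclideanSpace ℝ (Fin 3))) k))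
    (hsol : ∀ᵐ ω ∂Q, ∃ v : ℝ → UnitAddTorus (Fin 3) → EuclideanSpace ℝ (Fin 3),
      (∀ t, 0 ≤ t → MemLp (v t) 2 volume ∧
        ∀ k, mFourierCoeff (EuclideanSpace.complexify ∘ v t) k = pathExt ω.1 t k) ∧
      ∀ T, 0 < T → IsWeakNSSolutionForcedOn T ν (fun _ => f) (v 0) v ∧
        ∫⁻ t in Ioo 0 T, eGradNormSq (v t) < ∞) :
    ∃ Q' : Measure ↥(pathSpace R (pathLip ν (∫ x, ‖f x‖) R) : Set (Path (Fin 3))),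
      IsProbabilityMeasure Q' ∧
      Q'.map (pathShiftOn R (pathLip ν (∫ x, ‖f x‖) R) (pathShift_mapsTo R (pathLip ν (∫ x, ‖f x‖) R))) = Q' ∧
      (∀ t, 0 ≤ t → Q'.map (fun ω => fun k : Fin 3 → ℤ => pathExt ω.1 t k) =
        μ.map (fun u : Torus.energySpace (Fin 3) => fun k : Fin 3 → ℤ =>
          mFourierCoeff (EuclideanSpace.complexify ∘ (u.1 : UnitAddTorus (Fin 3) → EuclideanSpace ℝ (Fin 3))) k)) ∧
      (∀ᵐ ω ∂Q', ∃ s : ℝ, 0 ≤ s ∧ ∃ u : ℝ → UnitAddTorus (Fin 3) → EuclideanSpace ℝ (Fin 3),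
        IsGlobalLerayHopf ν (fun _ => f) (u 0) u ∧
        ∀ t, 0 ≤ t → MemLp (u t) 2 volume ∧
          ∀ k, mFourierCoeff (EuclideanSpace.complexify ∘ u t) k = pathExt ω.1 (s + t) k) := by
  sorry

/-! ### Stub 4 (M/L, known): the pathwise time-averaged energy inequality -/

/-- **Stub (pathwise coupling).** Along a path of `𝒦` realised after the shift `s ≥ 0` by a global
Leray–Hopf solution, the integer-window means of the resolved dissipation are controlled by those
of the energy: `A_n F_d ≤ c₀/n + ‖f‖₂ √(A_n F_e)` (the Leray–Hopf energy inequality from `0`,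
`ν∫₀ᵗ‖∇u‖² ≤ ½‖u(0)‖² + ∫₀ᵗ (f, u)`, Cauchy–Schwarz, Parseval `pathEnergyTot = ‖u‖²`,
`pathDiss ≤ ν‖∇u‖²`, and `pathDiss ≤ 4π²νK²R²` on the initial segment `[0, s]`).
[DoeringFoias2002 §2; FMRTTurbulence2001 IV §3.1 (3.4)] -/
theorem stub_pathwiseCoupling (hν : 0 < ν) (hf : IsSmooth f) (hf0 : HasZeroMean f) {R : ℝ}
    {L : (Fin 3 → ℤ) → ℝ} (ω : ↥(pathSpace R L : Set (Path (Fin 3)))) {s : ℝ} (hs : 0 ≤ s)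
    {u : ℝ → UnitAddTorus (Fin 3) → EuclideanSpace ℝ (Fin 3)}
    (hu : IsGlobalLerayHopf ν (fun _ => f) (u 0) u)
    (hcoef : ∀ t, 0 ≤ t → MemLp (u t) 2 volume ∧
      ∀ k, mFourierCoeff (EuclideanSpace.complexify ∘ u t) k = pathExt ω.1 (s + t) k)
    (K : ℕ) :
    ∃ c₀ : ℝ, ∀ n : ℕ, 0 < n →
      birkhoffAverage ℝ (pathShiftOn R L (pathShift_mapsTo R L)) (fun x => dissMean ν K x.1) n ω ≤
        c₀ / n + Real.sqrt (∫ x, ‖f x‖ ^ 2) *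
          Real.sqrt (birkhoffAverage ℝ (pathShiftOn R L (pathShift_mapsTo R L)) (fun x => energyMean x.1) n ω) := by
  sorry

/-! ### Proved glue: a.e. Birkhoff–Chebyshev selection and the Chebyshev gap -/

/-- **A.e. Birkhoff–Chebyshev selection** (a.e. variant of the landed
`MomentParity.exists_mem_support_birkhoff_limits`: the coupling is assumed only along a.e. point,
with a point-dependent constant, and the selected point is taken inside a prescribed conull set
`G`). On a probability space with a measure-preserving map `θ`, two nonnegative integrable
observables with `∫ F_e ≤ E`, `∫ F_d ≥ D` and the a.e. pathwise coupling
`A_n F_d ≤ c₀/n + A √(A_n F_e)` admit a point of `G` where both Birkhoff averages converge, to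
limits `e ≤ M`, `d ≥ D'`, as soon as `D' + A E/√M < D`. -/
theorem exists_good_point_ae {X : Type*} [MeasurableSpace X] (Q : Measure X) [IsProbabilityMeasure Q]
    {θ : X → X} (hθ : MeasurePreserving θ Q Q) {Fe Fd : X → ℝ} (hFe : Integrable Fe Q)
    (hFd : Integrable Fd Q) (hFe0 : ∀ x, 0 ≤ Fe x) (hFd0 : ∀ x, 0 ≤ Fd x) {A E D D' M : ℝ}
    (hA : 0 ≤ A) (hEint : ∫ x, Fe x ∂Q ≤ E) (hDint : D ≤ ∫ x, Fd x ∂Q) (hM : 0 < M) (hD'0 : 0 ≤ D')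
    (hgap : D' + A * E / Real.sqrt M < D)
    (hcouple : ∀ᵐ x ∂Q, ∃ c₀ : ℝ, ∀ n : ℕ, 0 < n →
      birkhoffAverage ℝ θ Fd n x ≤ c₀ / n + A * Real.sqrt (birkhoffAverage ℝ θ Fe n x))
    {G : X → Prop} (hG : ∀ᵐ x ∂Q, G x) :
    ∃ x, G x ∧ ∃ e d : ℝ,
      Tendsto (fun n => birkhoffAverage ℝ θ Fe n x) atTop (𝓝 e) ∧
      Tendsto (fun n => birkhoffAverage ℝ θ Fd n x) atTop (𝓝 d) ∧ e ≤ M ∧ D' ≤ d := by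
  -- Birkhoff for the two observables
  obtain ⟨es, hes_int, -, hes_eq, hes_lim⟩ :=
    Literature.Dynamics.Ergodic.birkhoff_ergodic_theorem_holds Q θ hθ Fe hFe
  obtain ⟨ds, hds_int, -, hds_eq, hds_lim⟩ :=
    Literature.Dynamics.Ergodic.birkhoff_ergodic_theorem_holds Q θ hθ Fd hFd
  -- nonnegativity of the averages and of the limits
  have havg_nonneg : ∀ (F : X → ℝ), (∀ x, 0 ≤ F x) → ∀ n x, 0 ≤ birkhoffAverage ℝ θ F n x := by
    intro F hF n x
    rw [birkhoffAverage, birkhoffSum]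
    exact smul_nonneg (inv_nonneg.2 n.cast_nonneg) (Finset.sum_nonneg fun i _ => hF _)
  -- the coupling passes to the limit: `d* ≤ A √e*`
  have hcouple_lim : ∀ᵐ x ∂Q, ds x ≤ A * Real.sqrt (es x) ∧ 0 ≤ es x ∧ 0 ≤ ds x := by
    filter_upwards [hcouple, hes_lim, hds_lim] with x ⟨c₀, hx⟩ hxe hxd
    refine ⟨?_, ge_of_tendsto' hxe fun n => havg_nonneg Fe hFe0 n x,
      ge_of_tendsto' hxd fun n => havg_nonneg Fd hFd0 n x⟩
    have h1 : Tendsto (fun n : ℕ => c₀ / n + A * Real.sqrt (birkhoffAverage ℝ θ Fe n x)) atTop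
        (𝓝 (0 + A * Real.sqrt (es x))) :=
      (tendsto_const_div_atTop_nhds_zero_nat c₀).add ((hxe.sqrt).const_mul A)
    rw [zero_add] at h1
    exact le_of_tendsto_of_tendsto hxd h1 (eventually_atTop.2 ⟨1, fun n hn => hx n hn⟩)
  -- Chebyshev: if no good point existed, `d* ≤ D' + A e* / √M` a.e., contradicting `∫ d* ≥ D`
  by_contra hno
  push Not at hno
  have hbad : ∀ᵐ x ∂Q, ds x ≤ D' + A / Real.sqrt M * es x := by
    filter_upwards [hG, hes_lim, hds_lim, hcouple_lim] with x hx hxe hxd ⟨hc, he0, hd0⟩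
    have hAM : 0 ≤ A / Real.sqrt M * es x := mul_nonneg (div_nonneg hA (Real.sqrt_nonneg _)) he0
    by_cases hcase : es x ≤ M
    · have h := hno x hx (es x) (ds x) hxe hxd hcase
      linarith
    · push Not at hcase
      have hsqM : 0 < Real.sqrt M := Real.sqrt_pos.2 hM
      have h1 : Real.sqrt (es x) ≤ es x / Real.sqrt M := by
        rw [le_div_iff₀ hsqM, ← Real.sqrt_mul he0]
        calc Real.sqrt (es x * M) ≤ Real.sqrt (es x * es x) := Real.sqrt_le_sqrt (by nlinarith)
          _ = es x := Real.sqrt_mul_self he0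
      have h2 : A * Real.sqrt (es x) ≤ A / Real.sqrt M * es x := by
        calc A * Real.sqrt (es x) ≤ A * (es x / Real.sqrt M) := mul_le_mul_of_nonneg_left h1 hA
          _ = A / Real.sqrt M * es x := by ring
      have hD'M : ds x ≤ A / Real.sqrt M * es x := hc.trans h2
      linarith
  -- integrate
  have hint_bad : ∫ x, ds x ∂Q ≤ D' + A / Real.sqrt M * ∫ x, es x ∂Q := by
    have h := integral_mono_ae hds_int ((integrable_const D').add (hes_int.const_mul (A / Real.sqrt M))) hbad
    have h2 : ∫ x, (fun _ => D') x + (fun x => A / Real.sqrt M * es x) x ∂Q =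
        D' + A / Real.sqrt M * ∫ x, es x ∂Q := by
      rw [integral_add (integrable_const D') (hes_int.const_mul _), integral_const, integral_const_mul,
        probReal_univ, one_smul]
    exact h.trans h2.le
  have hAM0 : 0 ≤ A / Real.sqrt M := div_nonneg hA (Real.sqrt_nonneg _)
  have h3 : A / Real.sqrt M * ∫ x, es x ∂Q ≤ A * E / Real.sqrt M := by
    rw [hes_eq]
    calc A / Real.sqrt M * ∫ x, Fe x ∂Q ≤ A / Real.sqrt M * E := mul_le_mul_of_nonneg_left hEint hAM0
      _ = A * E / Real.sqrt M := by ring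
  rw [hds_eq] at hint_bad
  linarith

/-- The arithmetic of the Chebyshev gap: with `M = 16 A² E² / ε² + 1` and `δ ≤ ε/8`,
`ε/2 + A E / √M < ε − δ` (copy of the landed `MomentParity.chebyshev_gap`). -/
theorem chebyshev_gap' {A E ε δ : ℝ} (hε : 0 < ε) (hδ : δ ≤ ε / 8) :
    ε / 2 + A * E / Real.sqrt (16 * A ^ 2 * E ^ 2 / ε ^ 2 + 1) < ε - δ := by
  set M := 16 * A ^ 2 * E ^ 2 / ε ^ 2 + 1 with hM
  have hMpos : 0 < M := by positivity
  have hsq : 0 < Real.sqrt M := Real.sqrt_pos.2 hMpos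
  have key : A * E / Real.sqrt M ≤ ε / 4 := by
    by_cases hAE : A * E ≤ 0
    · exact (div_nonpos_of_nonpos_of_nonneg hAE hsq.le).trans (by positivity)
    · push Not at hAE
      rw [div_le_iff₀ hsq]
      have h1 : 4 * (A * E) / ε ≤ Real.sqrt M := by
        rw [Real.le_sqrt (by positivity) hMpos.le, hM]
        have : (4 * (A * E) / ε) ^ 2 = 16 * A ^ 2 * E ^ 2 / ε ^ 2 := by
          field_simp; ring
        rw [this]
        linarith
      calc A * E = ε / 4 * (4 * (A * E) / ε) := by field_simp
        _ ≤ ε / 4 * Real.sqrt M := mul_le_mul_of_nonneg_left h1 (by positivity)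
  linarith

/-! ### Composition -/

/-- **Composition.** `StirringSphere.EnsembleRealization` (= the shared item
stmt-AnomalousDissipation-0215) from the four stubs, the a.e. selection and the landed
`MomentParity.stub_timeAverages`. -/
theorem ensembleRealization_of :
    Summit.AnomalousDissipation.AnomalousDissipation.Theses.StirringSphere.EnsembleRealization := by
  intro f hs hdiv hz E ε hε
  -- the constants of the statement (chosen before `ν`, `μ`)
  set Af : ℝ := Real.sqrt (∫ x, ‖f x‖ ^ 2) with hAf
  set M : ℝ := 16 * Af ^ 2 * E ^ 2 / ε ^ 2 + 1 with hM
  have hAf0 : 0 ≤ Af := Real.sqrt_nonneg _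
  have hMpos : 0 < M := by positivity
  refine ⟨M, fun ν μ hν hμ hint hE hεμ => ?_⟩
  haveI := hμ.prob
  -- the FMRT support ball and the trajectory space
  have hf2 : MemLp f 2 volume := hs.memLp 2
  set R : ℝ := ‖hf2.toLp f‖ / (4 * Real.pi ^ 2 * ν) with hR
  have hR0 : 0 ≤ R := div_nonneg (norm_nonneg _) (by positivity)
  have hRae : ∀ᵐ u ∂μ, ‖u‖ ≤ R := hμ.ae_norm_le hν hf2
  set L : (Fin 3 → ℤ) → ℝ := pathLip ν (∫ x, ‖f x‖) R with hL
  -- (1) the stationary superposition lift, (3) its admissible upgrade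
  obtain ⟨Q, hQprob, hQθ, hQmarg, hQsol⟩ := stub_superpositionLaw hν hs hdiv hz hμ hR0 hRae
  haveI := hQprob
  obtain ⟨P, hPprob, hPθ, hPmarg, hPreal⟩ :=
    stub_admissibleLift hν hs hdiv hz hμ hR0 hRae Q hQθ hQmarg hQsol
  haveI := hPprob
  -- (2) the two observables under `P`
  obtain ⟨hPE, hPD⟩ := stub_marginalMeans hν hμ P hPmarg
  obtain ⟨K, hK⟩ := hPD (ε / 8) (by positivity)
  have hEint : ∫ ω, energyMean ω.1 ∂P ≤ E := hPE ▸ hE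
  have hDint : ε - ε / 8 ≤ ∫ ω, dissMean ν K ω.1 ∂P := by linarith
  -- integrability and signs of the observables on the compact trajectory space
  have hFe : Integrable (fun x : ↥(pathSpace R L : Set (Path (Fin 3))) => energyMean x.1) P := by
    refine Integrable.of_bound (measurable_energyMean R L).aestronglyMeasurable (R ^ 2)
      (ae_of_all _ fun ω => ?_)
    rw [Real.norm_eq_abs, abs_of_nonneg (energyMean_mem_Icc ω.2).1]
    exact (energyMean_mem_Icc ω.2).2
  have hFd : Integrable (fun x : ↥(pathSpace R L : Set (Path (Fin 3))) => dissMean ν K x.1) P := by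
    haveI : CompactSpace ↥(pathSpace R L : Set (Path (Fin 3))) := compactSpace_pathSpace R L
    exact (continuous_dissMean R L ν K).integrable_of_hasCompactSupport
      (HasCompactSupport.of_compactSpace _)
  have hFe0 : ∀ x : ↥(pathSpace R L : Set (Path (Fin 3))), 0 ≤ energyMean x.1 := fun x =>
    (energyMean_mem_Icc x.2).1
  have hFd0 : ∀ x : ↥(pathSpace R L : Set (Path (Fin 3))), 0 ≤ dissMean ν K x.1 := fun x =>
    (dissMean_mem_Icc hν.le K x.2).1
  have hθP : MeasurePreserving (pathShiftOn R L (pathShift_mapsTo R L)) P P :=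
    ⟨(continuous_pathShiftOn R L).measurable, hPθ⟩
  have hgap : ε / 2 + Af * E / Real.sqrt M < ε - ε / 8 := chebyshev_gap' hε le_rfl
  -- (4) the pathwise coupling along realised paths
  have hcouple : ∀ᵐ ω ∂P, ∃ c₀ : ℝ, ∀ n : ℕ, 0 < n →
      birkhoffAverage ℝ (pathShiftOn R L (pathShift_mapsTo R L)) (fun x => dissMean ν K x.1) n ω ≤
        c₀ / n + Af * Real.sqrt
          (birkhoffAverage ℝ (pathShiftOn R L (pathShift_mapsTo R L)) (fun x => energyMean x.1) n ω) := by
    filter_upwards [hPreal] with ω ⟨s, hs0, u, hLH, hcoef⟩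
    exact stub_pathwiseCoupling hν hs hz ω hs0 hLH hcoef K
  -- Birkhoff–Chebyshev selection inside the realisation set
  obtain ⟨ω, ⟨s, hs0, u, hLH, hcoef⟩, e, d, he, hd, heM, hdD⟩ :=
    exists_good_point_ae P hθP hFe hFd hFe0 hFd0 hAf0 hEint hDint hMpos
      (by positivity : (0 : ℝ) ≤ ε / 2) hgap hcouple hPreal
  -- Birkhoff averages are integer-window means
  have he' : Tendsto (fun m : ℕ => (m : ℝ)⁻¹ * ∫ t in (0 : ℝ)..m, pathEnergyTot ω.1 t) atTop (𝓝 e) := by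
    refine he.congr fun m => ?_
    rw [birkhoffAverage, birkhoffSum_energyMean, smul_eq_mul]
  have hd' : Tendsto (fun m : ℕ => (m : ℝ)⁻¹ * ∫ t in (0 : ℝ)..m, pathDiss ν K ω.1 t) atTop (𝓝 d) := by
    refine hd.congr fun m => ?_
    rw [birkhoffAverage, birkhoffSum_dissMean, smul_eq_mul]
  -- the landed time-averages stub of the sibling line
  obtain ⟨hEu, hDu⟩ := stub_timeAverages hν hs hz ω.2 hs0 hLH hcoef K he' hd'
  exact ⟨u 0, u, hLH, hEu.trans heM, hdD.trans hDu⟩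

/-- The same composition for route Ensemble's byte-identical decl (the shared item closes both). -/
theorem ensemble_ensembleRealization_of :
    Summit.AnomalousDissipation.AnomalousDissipation.Theses.Ensemble.EnsembleRealization :=
  ensembleRealization_of

end Summit.AnomalousDissipation.AnomalousDissipation.Cruxes.EnsembleRealization.SuperpositionLift
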